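import Summits.BirchSwinnertonDyer.Rank1Residual.JET.CarrierReadingRecordsKitThree
import HarnessLib

/-!
# BSD rank-≤1 residual cell, lane class X4 (ADDITIVE at `3`, `ρ̄_{E,3}` onto), BOTH ranks, Tamagawa-OBSTRUCTED with ONE carrier prime `q ≠ 3`:
# `BSD(E,3)` PER CELL through the JET lane's R-IDX kit doors `JET.bsdp_of_jetRowA3F_tam_min` / `_tamX_min` (ANY reduction at `3`, `3`-adic
# tower by ONE Frobenius witness mod `9`; READING binder K1) on a two-engine HEEGNER-INDEX line in a DEEP field — records 04 (x11c GEN 36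
# «J1-REMAINDER / KOLY-R»)

HONEST FRAMING (cell `b2b-bsdres-*`, verbatim): prove what is provable now; shrink each hard class to its core with data; no claim beyond
stated classes; COMBINATION classes deleted from PUBLISHED theorems only, CONSTRUCTION-shaped remainder typed; this is not "finishing BSD".
X4 / X11b (and X11 ∧ r = 1 ∧ p = 3) stay CONSTRUCTION-SHAPED; everything here is PER CELL; no lane verdict is changed; NO named fact is
introduced (debt 0) and NO definition; nothing is booked by this file (bookings are referee A's, pub-bsdpct); Cremona's numbers (`r_an`,
`#Ш_an`, models, generators, `∏ c_ℓ`, torsion, optimality / Manin codes, the galrep datum) and the Kurihara lane's per-prime tables are INPUTS.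

Unit `b2b-bsdres-x11c`, GEN 36 (prover-b2b-bsdres-x11c-g36-0), move «J1-REMAINDER / KOLY-R». POPULATION (`HOME/b2b-bsdres-x11c/gen36/pop/`:
`census36.py` over referee A's ROUND 983 state of record × the Kurihara lane's sweep records × Cremona, then `build_pop36.py`): EVERY live
residue cell on the Kolyvagin / Jetchev road classes (X4, X7, X8, X11a, X11b), BOTH ranks, odd `p`, whose shape is KOLY (`ρ̄_{E,p}` onto,
`p ∤ #E(ℚ)_tors·∏c·#Ш_an`: 30 cells) or J1 (onto, `p ∤ #E(ℚ)_tors·#Ш_an`, exactly ONE prime `q ∣ N` with `p ∣ c_q`: 171 cells; the two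
J1 cells whose carrier is an ADDITIVE `p` have no door and are excluded) — 199 cells on 191 classes (188 of them with this cell as their ONLY
open cell): 82 rank-one `(3, X11b)`, 59 `(5, X4)` + 2 `(7, X4)` (rank one 19 / rank zero 42), 26 `(3, X4)` J1 (1 / 25), 20 `(3, X4)` KOLY
(6 / 14), 10 KOLY at `p ≥ 5`. The lane never certified them: at rank one its Heegner fields (`|D| ≤ 1511`) read `ord_p [E(K):ℤy_K] = w + 1`
or found no admissible field; at rank zero (additive `p`) no Heegner-index line was ever run. THIS UNIT ran the cell's engines VERBATIM in
DEEPER fields: engine 1 = gen 3 `engine1_cha1b/main.py` = x9-g7 `jobD1b.py` (cypari2, sha256 `69e29ec7…`; rank-one mode: Cremona's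
generator, `hy = L'(E,1)·L(E^D,1)·√|D|/(4·Area)`, `m = √(4·hy/ĥ(P))`; rank-zero mode: the rank-one twist `F = E^D`, a point `x ∈ F(ℚ)` by
`ellrank`, saturated, `hy = L(E,1)·L'(F,1)·√|D|/(4·Area)`, `m = √(4·hy/ĥ(x))` — Miller 2011 Thm. 4.1 / Cor. 4.8; `NDISC 16`, `DBOUND 6000`);
engine 2 = gen 3 `run_cert.py` (`1b54bb20…`) + `e2lib.py` + `tate_stdlib.py` (stdlib re-implementation: `m`, `ord_p m` must be EQUAL,
discrete checks); twist values = additive-p1 `twistvals/main.py` (`e501b988…`). Kit jobs: see HOME/b2b-bsdres-x11c/gen36/harvest/JOBS-gen36.txt. Evidence `HOME/b2b-bsdres-x11c/gen36/`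
(POP36.md, ROWS36-TABLE.md, harvest outputs with inputs.sha256, SHA256SUMS); REPORT.md §45.

THE ROAD (cell `bsd-jet`'s R-IDX grammar, the doors referee A priced at pub-bsdpct ROUNDS 409 / 516 / 600 and booked this unit's
JDEEP rows on at ROUND 890): Jetchev 2008 Thm. 1.4 / Cor. 1.5 READ at the ONE Tamagawa carrier — READING binder K1
`JET.JetchevDivisibilityCarrierNe` (p459625; carrier `q ≠ p`) or K3 `JET.JetchevDivisibilityCarrierMult` (p463660; carrier `q = p` split
multiplicative), both `@[conjecture]` typed readings CONSUMED AS HYPOTHESES (nothing about K1 / K3 is asserted here) — + McCallum 1991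
Cor. 5.6 (`hMcU`), GZK (`hGZK`), Kolyvagin / Gross–Zagier bookkeeping (`hKo`, `hrec`, `hD36`, `hlev`): with `w = ord_p c_q` at the carrier
and a Heegner field `K` in which `ord_p [E(K):ℤy_K] ≤ w`, `Ш(E/ℚ)[p] = 0`, and with `ord_p #Ш_an = 0`, Miller's `BSD(E,p)`.
IN THE KERNEL per cell (`decide` / `norm_num` goals of ONE kit application): the literal Cremona model (`Δ ≠ 0`; global minimality by the
factored Kraus criterion `Supersingular.isGloballyMinimal_of_krausCriterion₃_factored` on the COMPLETE factorisation of `|Δ|`); `ρ̄_{E,p}`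
ONTO (Serre 1972: three Prop-19 witnesses at `p ≥ 5` / an irreducible Frobenius + a Frobenius of order `3` at `p = 3`; the `p`-adic tower
inside the door: Serre IV-23 at `p ≥ 5`, the Tate line at a multiplicative `3`, ONE Frobenius witness mod `9` otherwise); at a
multiplicative `3`: `3 ∣ Δ`, `3 ∤ c₄`; the carrier's Tamagawa number from ONE `TamLocal` (split `I_n`) or exact `TamX` (`IV` / `IV*`)
certificate (n1011-p03's bridges `Additive.IntModelTam.localTamagawaNumber_padic_eq_of_intModel_of_tamLocal` / `_of_tamX`) and
`w ≤ ord_p c_q`. DISPLAYED (hypotheses of every record): `hJ` (READING), `hMcU`, `hGZK`, `hKo`, `hrec`, `hD36`, `hlev`; the Heegner datum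
(`K` imaginary quadratic, `d_K ∉ {−3, −4}`, Heegner hypothesis for the level `N`, `P` a Heegner point of infinite order), bucket A: `q ∣ N`;
the INDEX LINE `hv : ord_p [E(K):ℤP] ≤ w` — THIS UNIT's two-engine deep-field datum, quoted per docstring, NOT re-computed here —;
`hr : r_an ≤ 1`; `hs` / `hvs` : `#Ш_an` a `p`-adic unit (Cremona; exact at rank 0).
What a record is worth is the referee's call (EVIDENCE-grade certificate under displayed binders, as every Heegner-index record of the
cell). Cells in this file: `493758b1`@3, `493974g1`@3, `494514e1`@3.

References: D. Jetchev, Compos. Math. 144 (2008) Thm. 1.4, Cor. 1.5 [Jetchev2008]; W. McCallum, LMS LN 153 (1991) §1, Cor. 5.6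
[McCallumLMS1991]; B. H. Gross, LMS LN 153 (1991) Prop. 2.1 [GrossLMS1991]; V. A. Kolyvagin (1990) [KolyvaginEulerSystems1990];
J.-P. Serre, Invent. Math. 15 (1972) §2.4 Prop. 15, §2.8 Prop. 19 [Serre1972]; J.-P. Serre, *Abelian ℓ-adic representations* IV-23
[SerreAbelianLadic1968]; B. H. Gross, D. Zagier, Invent. Math. 84 (1986) [GrossZagier1986]; R. L. Miller, LMS J. Comput. Math. 14 (2011)
Thm. 4.1, Cor. 4.8, Def. 1.1 [Miller2011LMS]; C. Wuthrich, Doc. Math. 19 (2014) Lemma 20 [Wuthrich2014]; J. H. Silverman, *AEC* (2009)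
VII.1, VII.5 [SilvermanAEC2009], *ATAEC* (1994) IV.9.4 [SilvermanATAEC1994]; A. Kraus, Acta Arith. 54 (1989) [Kraus1989]; Cremona's
tables [Cremona2006].
-/

set_option autoImplicit false

noncomputable section

open scoped Classical

open WeierstrassCurve Literature.NumberTheory.EllipticCurves
  Literature.NumberTheory.EllipticCurves.ModularForms
  Literature.NumberTheory.EllipticCurves.Rank1Residual
  Literature.NumberTheory.EllipticCurves.Rank1Residual.Typed
  Literature.NumberTheory.EllipticCurves.Rank1Residual.X11RankOneCertificates
  Summit.BirchSwinnertonDyer.BirchSwinnertonDyer.Rank1Residual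
  Summit.BirchSwinnertonDyer.BirchSwinnertonDyer.Rank1Residual.IntModel
  Summit.BirchSwinnertonDyer.BirchSwinnertonDyer.Rank1Residual.X11RankOne
  Summit.BirchSwinnertonDyer.BirchSwinnertonDyer.Rank2Observatory.Tam
  Summit.BirchSwinnertonDyer.Rank1Residual.JET

namespace Summit.BirchSwinnertonDyer.Rank1Residual.X4

/-- **`BSD(E,3)` for `493758b1`** (cell `(493758b1, 3)`, class X4, rank 0; JET grammar key `JETA:493758b1@3`, bucket A at `p = 3`, `E` additive at
`3` (door `JET.bsdp_of_jetRowA3F_tam_min`, `3`-adic tower by a Frobenius witness mod `9`)); `N = 493758 = 2·3^2·27431`, additive `I0*` at `3`, `r_an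
= 0`, `#E(ℚ)_tors = 1`, `∏c = 9`, `#Ш_an = 1`, Cremona galrep: no code at this prime (`ρ̄_{E,3}` onto); `|Δ| = ∏` over `[(2, 9), (3, 6), (27431,
1)]` (factored Kraus criterion, every disjunct decided). The ONE carrier: carrier `q = 2` (split `I9`, `c_q = 9`, `w = ord_3 c_q = 2`; IN THE KERNEL
by the `TamLocal` certificate `⟨2, 1, 1, 0, 0, 0, 0, 9, 0, 0, 9⟩`); READING binder `hJ` = K1 `JetchevDivisibilityCarrierNe`; displayed index line
`hv : ord_3 [E(K):ℤP] ≤ 2`. Serre Prop-15 witnesses mod `3`: `(ℓ, #Ẽ(𝔽_ℓ))` = `(5, 2)` (`X² − aX + ℓ` root-free over `𝔽₃`), `(7, 6)` (`ℓ ≡ 1`, `a ≡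
2 (mod 3)`, `9 ∤ #Ẽ`); `3`-adic tower witness `(ℓ₉, #Ẽ) = (29, 33)` (`ℓ₉ ≡ 2 (mod 9)`, `a_ℓ₉ ≡ 6 (mod 9)`). Kurihara lane note of record: «additive
p, irreducible». State of record (referee A ROUND 983, `scratchA_A_state_after_x4gh_add3_onA2R977_fold.pkl`): class `residue`, 1 open cell(s),
register empty. Other engine-1 fields tried (`D`: `m` (`ord_3 m`)): `-119`: `m = 36` (`ord = 2`); `-215`: `m = 36` (`ord = 2`); `-359`: `m = 54`
(`ord = 3`); `-383`: `m = 36` (`ord = 2`); `-407`: `m = 36` (`ord = 2`); `-431`: `m = 54` (`ord = 3`); `-527`: `m = 36` (`ord = 2`); `-551`: `m =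
36` (`ord = 2`); `-623`: `m = 36` (`ord = 2`); `-647`: `m = 72` (`ord = 2`); `-815`: `m = 72` (`ord = 2`). THIS UNIT'S DATUM (displayed, NOT
re-computed here): DEEP FIELD `K = ℚ(√-71)` (`71` = prime): rank-one twist `F = E^D` (`N_F = 2489034078`), point `x` on `F` by ellrank0 (saturated
at the primes `< 100`), **`m = [E(K):ℤy_K] = 36`, `ord_3 m = 2`** (`ρ = m²/4`, `L(E,1) = 11.444392126`, `L'(F,1) = 29.337799134`, `ĥ(x) =
8.5319793707`) — engine 1 j293243 = engine 2 j295408: `m = 36` EQUAL (FAIL:p2_not_div_N, dev ≤ 3.6e-15); twist `E^D` (j293857): `N = 2489034078`,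
`#tors·∏c·#Ш_an = 1·36·1`, `ord_3 #Ш_an(E^D) = 0`, `ord_3 ∏c(E^D) = 2` (BSD-consistent). CONDITIONAL on every binder; per cell; nothing booked by
this file.
[cite: Jetchev2008, Thm. 1.4 and Cor. 1.5 (p. 812)] [cite: McCallumLMS1991, Cor. 5.6] [cite: Serre1972, §2.4 Prop. 15, §2.8 Prop. 19] [cite: Cremona2006, Table 1 (label 493758b1)] -/
theorem bsdpJD_493758b1_3
    (hJ : JetchevDivisibilityCarrierNe)
    (hMcU : McCallum1991_padicValNat_card_sha_primary_add_le_of_globalDivisibility)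
    (hGZK : rank_eq_analyticRank_of_analyticRank_le_one)
    (hKo : ∀ (N : ℕ) [NeZero N] (W : WeierstrassCurve ℚ) (K : Type) [Field K] [NumberField K], kolyvagin N W K)
    (hrec : ∀ (N : ℕ) [NeZero N] (W : WeierstrassCurve ℚ) (K : Type) [Field K] [NumberField K],
      heegnerPointOfConductor_one_galoisConj N W K)
    (hD36 : ∀ (N : ℕ) [NeZero N] (W : WeierstrassCurve ℚ) (K : Type) [Field K] [NumberField K],
      phi_heegnerTau_mem_singularModuliField N W K)
    (hlev : ∀ {N : ℕ} [NeZero N], IsNewformOf.level_eq_conductorNorm (N := N))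
    (W : WeierstrassCurve ℚ) (hW : W = ⟨1, -1, 1, -1253, 16669⟩)
    {N : ℕ} [NeZero N] {K : Type} [Field K] [NumberField K] (hK : IsImaginaryQuadratic K)
    (hD3 : NumberField.discr K ≠ -3) (hD4 : NumberField.discr K ≠ -4)
    (hH : SatisfiesHeegnerHypothesis N K) {P : (W.baseChange K).toAffine.Point}
    (hP : IsHeegnerPoint N W K P) (hnt : ¬ IsOfFinAddOrder P) (hqN : 2 ∣ N)
    (hv : padicValNat 3 (AddSubgroup.zmultiples P).index ≤ 2)
    (hr : W.analyticRank ≤ 1) {s : ℚ} (hs : shaAn W = (s : ℂ)) (hvs : padicValRat 3 s = 0) : BSDp W 3 :=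
  bsdp_of_jetRowA3F_tam_min 1 (-1) 1 (-1253) 16669
    (Supersingular.isGloballyMinimal_of_krausCriterion₃_factored 1 (-1) 1 (-1253) 16669 [(2, 9), (3, 6), (27431, 1)] (by decide +kernel)
      (by intro t ht; fin_cases ht <;> norm_num) (by decide +kernel))
    5 7 (by norm_num) (by norm_num) (by decide) (by decide) (by decide) (by decide) (by decide +kernel) (by decide +kernel)
    (n₁ := 2) (n₂ := 6) (by decide +kernel) (by decide +kernel) (by decide) (by decide) (by decide) (by decide)
    29 (by norm_num) (by decide) (by decide +kernel) (n₉ := 33) (by decide +kernel) (by decide) (by decide)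
    2 ⟨2, 1, 1, 0, 0, 0, 0, 9, 0, 0, 9⟩ rfl (by decide +kernel) (c := 9) (by decide +kernel) (w := 2) (by decide +kernel) (by decide)
    hJ hMcU hGZK hKo hrec hD36 hlev W hW hK hD3 hD4 hH hP hnt hqN hv hr hs hvs

/-- **`BSD(E,3)` for `493974g1`** (cell `(493974g1, 3)`, class X4, rank 0; JET grammar key `JETA:493974g1@3`, bucket A at `p = 3`, `E` additive at
`3` (door `JET.bsdp_of_jetRowA3F_tam_min`, `3`-adic tower by a Frobenius witness mod `9`)); `N = 493974 = 2·3^2·13·2111`, additive `I0*` at `3`,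
`r_an = 0`, `#E(ℚ)_tors = 1`, `∏c = 18`, `#Ш_an = 1`, Cremona galrep: no code at this prime (`ρ̄_{E,3}` onto); `|Δ| = ∏` over `[(2, 9), (3, 6), (13,
1), (2111, 2)]` (factored Kraus criterion, every disjunct decided). The ONE carrier: carrier `q = 2` (split `I9`, `c_q = 9`, `w = ord_3 c_q = 2`; IN
THE KERNEL by the `TamLocal` certificate `⟨2, 1, 1, 0, 0, 0, 0, 9, 0, 0, 9⟩`); READING binder `hJ` = K1 `JetchevDivisibilityCarrierNe`; displayed
index line `hv : ord_3 [E(K):ℤP] ≤ 2`. Serre Prop-15 witnesses mod `3`: `(ℓ, #Ẽ(𝔽_ℓ))` = `(5, 7)` (`X² − aX + ℓ` root-free over `𝔽₃`), `(31, 24)`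
(`ℓ ≡ 1`, `a ≡ 2 (mod 3)`, `9 ∤ #Ẽ`); `3`-adic tower witness `(ℓ₉, #Ẽ) = (29, 36)` (`ℓ₉ ≡ 2 (mod 9)`, `a_ℓ₉ ≡ 3 (mod 9)`). Kurihara lane note of
record: «additive p, irreducible». State of record (referee A ROUND 983, `scratchA_A_state_after_x4gh_add3_onA2R977_fold.pkl`): class `residue`, 1
open cell(s), register empty. Other engine-1 fields tried (`D`: `m` (`ord_3 m`)): `-191`: `m = 36` (`ord = 2`); `-287`: `m = 36` (`ord = 2`);
`-311`: `m = 36` (`ord = 2`); `-407`: `m = 36` (`ord = 2`); `-503`: `m = 36` (`ord = 2`); `-719`: `m = 36` (`ord = 2`); `-815`: `m = 36` (`ord =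
2`); `-935`: `m = 36` (`ord = 2`); `-1343`: `m = 36` (`ord = 2`). THIS UNIT'S DATUM (displayed, NOT re-computed here): DEEP FIELD `K = ℚ(√-23)`
(`23` = prime): rank-one twist `F = E^D` (`N_F = 261312246`), point `x` on `F` by ellrank0 (saturated at the primes `< 100`), **`m = [E(K):ℤy_K] =
36`, `ord_3 m = 2`** (`ρ = m²/4`, `L(E,1) = 3.2742648955`, `L'(F,1) = 32.865944843`, `ĥ(x) = 6.4074850766`) — engine 1 j293245 = engine 2 j295408:
`m = 36` EQUAL (FAIL:p2_not_div_N, dev ≤ 1.9e-14); twist `E^D` (j293857): `N = 261312246`, `#tors·∏c·#Ш_an = 1·36·1`, `ord_3 #Ш_an(E^D) = 0`, `ord_3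
∏c(E^D) = 2` (BSD-consistent). CONDITIONAL on every binder; per cell; nothing booked by this file.
[cite: Jetchev2008, Thm. 1.4 and Cor. 1.5 (p. 812)] [cite: McCallumLMS1991, Cor. 5.6] [cite: Serre1972, §2.4 Prop. 15, §2.8 Prop. 19] [cite: Cremona2006, Table 1 (label 493974g1)] -/
theorem bsdpJD_493974g1_3
    (hJ : JetchevDivisibilityCarrierNe)
    (hMcU : McCallum1991_padicValNat_card_sha_primary_add_le_of_globalDivisibility)
    (hGZK : rank_eq_analyticRank_of_analyticRank_le_one)
    (hKo : ∀ (N : ℕ) [NeZero N] (W : WeierstrassCurve ℚ) (K : Type) [Field K] [NumberField K], kolyvagin N W K)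
    (hrec : ∀ (N : ℕ) [NeZero N] (W : WeierstrassCurve ℚ) (K : Type) [Field K] [NumberField K],
      heegnerPointOfConductor_one_galoisConj N W K)
    (hD36 : ∀ (N : ℕ) [NeZero N] (W : WeierstrassCurve ℚ) (K : Type) [Field K] [NumberField K],
      phi_heegnerTau_mem_singularModuliField N W K)
    (hlev : ∀ {N : ℕ} [NeZero N], IsNewformOf.level_eq_conductorNorm (N := N))
    (W : WeierstrassCurve ℚ) (hW : W = ⟨1, -1, 1, -29603, -1965725⟩)
    {N : ℕ} [NeZero N] {K : Type} [Field K] [NumberField K] (hK : IsImaginaryQuadratic K)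
    (hD3 : NumberField.discr K ≠ -3) (hD4 : NumberField.discr K ≠ -4)
    (hH : SatisfiesHeegnerHypothesis N K) {P : (W.baseChange K).toAffine.Point}
    (hP : IsHeegnerPoint N W K P) (hnt : ¬ IsOfFinAddOrder P) (hqN : 2 ∣ N)
    (hv : padicValNat 3 (AddSubgroup.zmultiples P).index ≤ 2)
    (hr : W.analyticRank ≤ 1) {s : ℚ} (hs : shaAn W = (s : ℂ)) (hvs : padicValRat 3 s = 0) : BSDp W 3 :=
  bsdp_of_jetRowA3F_tam_min 1 (-1) 1 (-29603) (-1965725)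
    (Supersingular.isGloballyMinimal_of_krausCriterion₃_factored 1 (-1) 1 (-29603) (-1965725) [(2, 9), (3, 6), (13, 1), (2111, 2)] (by decide +kernel)
      (by intro t ht; fin_cases ht <;> norm_num) (by decide +kernel))
    5 31 (by norm_num) (by norm_num) (by decide) (by decide) (by decide) (by decide) (by decide +kernel) (by decide +kernel)
    (n₁ := 7) (n₂ := 24) (by decide +kernel) (by decide +kernel) (by decide) (by decide) (by decide) (by decide)
    29 (by norm_num) (by decide) (by decide +kernel) (n₉ := 36) (by decide +kernel) (by decide) (by decide)
    2 ⟨2, 1, 1, 0, 0, 0, 0, 9, 0, 0, 9⟩ rfl (by decide +kernel) (c := 9) (by decide +kernel) (w := 2) (by decide +kernel) (by decide)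
    hJ hMcU hGZK hKo hrec hD36 hlev W hW hK hD3 hD4 hH hP hnt hqN hv hr hs hvs

/-- **`BSD(E,3)` for `494514e1`** (cell `(494514e1, 3)`, class X4, rank 0; JET grammar key `JETA:494514e1@3`, bucket A at `p = 3`, `E` additive at
`3` (door `JET.bsdp_of_jetRowA3F_tam_min`, `3`-adic tower by a Frobenius witness mod `9`)); `N = 494514 = 2·3^2·83·331`, additive `I0*` at `3`,
`r_an = 0`, `#E(ℚ)_tors = 1`, `∏c = 36`, `#Ш_an = 1`, Cremona galrep: no code at this prime (`ρ̄_{E,3}` onto); `|Δ| = ∏` over `[(2, 36), (3, 6),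
(83, 1), (331, 1)]` (factored Kraus criterion, every disjunct decided). The ONE carrier: carrier `q = 2` (split `I36`, `c_q = 36`, `w = ord_3 c_q =
2`; IN THE KERNEL by the `TamLocal` certificate `⟨2, 1, 1, 0, 0, 0, 0, 36, 0, 0, 36⟩`); READING binder `hJ` = K1 `JetchevDivisibilityCarrierNe`;
displayed index line `hv : ord_3 [E(K):ℤP] ≤ 2`. Serre Prop-15 witnesses mod `3`: `(ℓ, #Ẽ(𝔽_ℓ))` = `(19, 20)` (`X² − aX + ℓ` root-free over `𝔽₃`),
`(37, 30)` (`ℓ ≡ 1`, `a ≡ 2 (mod 3)`, `9 ∤ #Ẽ`); `3`-adic tower witness `(ℓ₉, #Ẽ) = (23, 21)` (`ℓ₉ ≡ 5 (mod 9)`, `a_ℓ₉ ≡ 3 (mod 9)`). Kurihara lane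
note of record: «additive p, irreducible». State of record (referee A ROUND 983, `scratchA_A_state_after_x4gh_add3_onA2R977_fold.pkl`): class
`residue`, 1 open cell(s), register empty. Other engine-1 fields tried (`D`: `m` (`ord_3 m`)): `-263`: `m = 72` (`ord = 2`); `-623`: `m = 288` (`ord
= 2`). THIS UNIT'S DATUM (displayed, NOT re-computed here): DEEP FIELD `K = ℚ(√-47)` (`47` = prime): rank-one twist `F = E^D` (`N_F = 1092381426`),
point `x` on `F` by ellrank0 (saturated at the primes `< 100`), **`m = [E(K):ℤy_K] = 72`, `ord_3 m = 2`** (`ρ = m²/4`, `L(E,1) = 9.3555280648`,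
`L'(F,1) = 19.734741833`, `ĥ(x) = 20.108516838`) — engine 1 j293243 = engine 2 j295408: `m = 72` EQUAL (FAIL:p2_not_div_N, dev ≤ 4.3e-15); twist
`E^D` (j293857): `N = 1092381426`, `#tors·∏c·#Ш_an = 1·72·1`, `ord_3 #Ш_an(E^D) = 0`, `ord_3 ∏c(E^D) = 2` (BSD-consistent). CONDITIONAL on every
binder; per cell; nothing booked by this file.
[cite: Jetchev2008, Thm. 1.4 and Cor. 1.5 (p. 812)] [cite: McCallumLMS1991, Cor. 5.6] [cite: Serre1972, §2.4 Prop. 15, §2.8 Prop. 19] [cite: Cremona2006, Table 1 (label 494514e1)] -/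
theorem bsdpJD_494514e1_3
    (hJ : JetchevDivisibilityCarrierNe)
    (hMcU : McCallum1991_padicValNat_card_sha_primary_add_le_of_globalDivisibility)
    (hGZK : rank_eq_analyticRank_of_analyticRank_le_one)
    (hKo : ∀ (N : ℕ) [NeZero N] (W : WeierstrassCurve ℚ) (K : Type) [Field K] [NumberField K], kolyvagin N W K)
    (hrec : ∀ (N : ℕ) [NeZero N] (W : WeierstrassCurve ℚ) (K : Type) [Field K] [NumberField K],
      heegnerPointOfConductor_one_galoisConj N W K)
    (hD36 : ∀ (N : ℕ) [NeZero N] (W : WeierstrassCurve ℚ) (K : Type) [Field K] [NumberField K],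
      phi_heegnerTau_mem_singularModuliField N W K)
    (hlev : ∀ {N : ℕ} [NeZero N], IsNewformOf.level_eq_conductorNorm (N := N))
    (W : WeierstrassCurve ℚ) (hW : W = ⟨1, -1, 1, -409415, 115656383⟩)
    {N : ℕ} [NeZero N] {K : Type} [Field K] [NumberField K] (hK : IsImaginaryQuadratic K)
    (hD3 : NumberField.discr K ≠ -3) (hD4 : NumberField.discr K ≠ -4)
    (hH : SatisfiesHeegnerHypothesis N K) {P : (W.baseChange K).toAffine.Point}
    (hP : IsHeegnerPoint N W K P) (hnt : ¬ IsOfFinAddOrder P) (hqN : 2 ∣ N)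
    (hv : padicValNat 3 (AddSubgroup.zmultiples P).index ≤ 2)
    (hr : W.analyticRank ≤ 1) {s : ℚ} (hs : shaAn W = (s : ℂ)) (hvs : padicValRat 3 s = 0) : BSDp W 3 :=
  bsdp_of_jetRowA3F_tam_min 1 (-1) 1 (-409415) 115656383
    (Supersingular.isGloballyMinimal_of_krausCriterion₃_factored 1 (-1) 1 (-409415) 115656383 [(2, 36), (3, 6), (83, 1), (331, 1)] (by decide +kernel)
      (by intro t ht; fin_cases ht <;> norm_num) (by decide +kernel))
    19 37 (by norm_num) (by norm_num) (by decide) (by decide) (by decide) (by decide) (by decide +kernel) (by decide +kernel)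
    (n₁ := 20) (n₂ := 30) (by decide +kernel) (by decide +kernel) (by decide) (by decide) (by decide) (by decide)
    23 (by norm_num) (by decide) (by decide +kernel) (n₉ := 21) (by decide +kernel) (by decide) (by decide)
    2 ⟨2, 1, 1, 0, 0, 0, 0, 36, 0, 0, 36⟩ rfl (by decide +kernel) (c := 36) (by decide +kernel) (w := 2) (by decide +kernel) (by decide)
    hJ hMcU hGZK hKo hrec hD36 hlev W hW hK hD3 hD4 hH hP hnt hqN hv hr hs hvs

end Summit.BirchSwinnertonDyer.Rank1Residual.X4

end
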